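import Summits.NavierStokesRegularity.FluidComputer.GateBudgetEnvelopeGate
import Summits.NavierStokesRegularity.FluidComputer.GateBudgetPulseKnob
import HarnessLib

/-!
# What no tuning can beat, part 12: THE SINGLE-TRAJECTORY NECESSITY SKELETON for the knob family
# `rotorCircuit K M ε ρ` — pulse band, end-game, duration, entry, and the fired inequality

Cell `pub-fluidc`, blueprint seat bp1 (gen 27); same namespace and conventions as parts 1–11
(`GateBudget*.lean`); this part imports part 9 (`GateBudgetEnvelopeGate`: the crude carrier law
`carrier_crude_lower` and the envelope ceiling) and part 11 (`GateBudgetPulseKnob`: the knob forms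
of the residence / transit laws; part 10 and `GateBudgetAfterglow` — `carrier_freeze`,
`clock_stays_reversed` — come with them). HONEST FRAMING (verbatim): low prior, high
value-of-information experiment on Tao's machine paradigm; NOT a claim that NS blows up. Five-mode
quadratic ODEs on `ℝ⁵` started EXACTLY at (5.6) `delayInit`; Tao's (5.5) is the member `ρ = ε`,
`M = K¹⁰`; nothing is proved about the Navier–Stokes equations.

## What this part records (SPEC-INPUT-bp1 §T, item S13″d)

Write `E = a² + d²` (the CARRIER: input mode plus transfer mode), `u = c/ρ²` (the rotor's turning
rate), `ã = X·4` (the output). Robust firing means `ã(t_f)² ≥ 1 - δ`; by the energy identity the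
carrier left over at `t_f` is then `≤ δ`. The necessity question of the cell (S13″: "how small must
the seed knob `σ_knob = ρ²/ε` be for the device to fire to deficit `δ`") is therefore a LOWER bound
on the carrier that survives the pulse. This part proves, for EVERY exact trajectory of EVERY
member (`0 < ρ² ≤ ε ≤ 1`, `0 < M`, `0 ≤ K`), the chain

* §30 PULSE BAND `knob_carrier_crude_lower`: `E(t) ≥ e^{-2(2ε+K)(t-s)}·E(s)` (`0 ≤ s ≤ t`) — the
  carrier cannot be drained faster than rate `2(2ε + K)` (part 9's crude law with `|b| ≤ 1`,
  seed `ρ²e^{-M} ≤ ε`);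
* §31 END-GAME `knob_carrier_freeze` / `_selftimed`: once the clock is dead (`b(T) ≤ -β < 0`) the
  input mode is frozen: on `[T, T + β/(2ε)]`,
  `a(t)² ≥ a(T)² - 4ε(u(T) + ε)/(Mβ) - 4e^{-M}/M` (afterglow law of part 5 in knob units: the
  catalyst's total remaining ACTION is `≲ u(T)·ε/(Mβ)`);
* §32 DURATION `knob_pulse_duration`: with the clock phases of the pulse — alive `b ≥ β` on
  `[s₀,t₁]`, in transit on `[t₁,t₂]` with `c ≥ γ`, `Mγ² > ε²`, dead `b ≤ -β` on `[t₂,T₀]` — the time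
  `u` spends above the exit level `λ₀` is at most
  `(ε/(Mβ))·log(2εt₁/(λ₁ρ²)) + 2εβ/(Mγ² - ε²) + (ε/(Mβ))·log(u(t₂)/(λ₀ - εe^{-M}/(Mβ)))`
  (parts 10/11: rise residence + transit + decay residence) — LOGARITHMIC in `1/σ_knob`;
* §33 ENTRY `knob_carrier_enter`: `E(s) ≥ 1 - 4ε²s² - ã(s)²` (energy identity + trigger budget);
* §34 THE FIRED INEQUALITY `knob_fired_carrier_lower`, `knob_fired_necessity`: if the pulse lasts
  `≤ τ`, exits with the clock dead at level `β` and with CARRIER PHASE `E(T₀) ≤ κ·a(T₀)²`, and the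
  device has fired to deficit `δ` at some `t_f ∈ [T₀, T₀ + β/(2ε)]`, then
  `e^{-2(2ε+K)τ}·(1 - 4ε²s₀² - ã(s₀)²) ≤ κ·(δ + 4ε(u(T₀) + ε)/(Mβ) + 4e^{-M}/M)`;
* §35 THE SKELETON `knob_necessity_skeleton`: §32's `τ` substituted — with `β ≍ ε`, `λ₀, λ₁ ≍ M·c₀`
  the left side is `≍ σ_knob^{4K/(M·β/ε)}·(1 - ã(s₀)²)`: robust firing to deficit `δ` FORCES
  `σ_knob ≲ (κδ)^{Mβ/(4Kε)}` UNLESS the carrier exits the pulse in quadrature (`κ` large);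
* §36 REFINEMENT `knob_carrier_three_bands`: on a TOP band where the rotor over-turns the drain
  (`u ≥ Λ ≥ max(1,K)`) and the output is still `≤ θ₁`, part 9's envelope ceiling replaces the crude
  rate by `Kθ₁ + η` — the three-band product lower bound on `E(T₀)` (not used in §35).

HONEST LIMITS. (1) CONDITIONAL: the clock-phase windows (`β`, `γ`, `t₁`, `t₂`), the exit phase `κ`
and the entry time `s₀` are HYPOTHESES about the trajectory, exactly as the window hypotheses of
parts 5–11; the theorems are the bookkeeping that turns them into the fired inequality. Selecting
the phase (`κ = O(1)` generically — the cell's toy `pub-fluidc-bp1/data/g23-toy` measured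
`|cos φ_exit|` spread over `(0,1]`, with "lucky" quadrature exits `σ_n ≈ 1/(M(n + 0.56))` firing at
large `σ_knob`) is the OPEN item S13″c; nothing here excludes it. (2) The pulse band uses the CRUDE
rate `2(2ε + K)` (all carrier in the transfer mode, drain wide open), so §35 has content only when
the pulse is short against `1/K` (`M ≫ K·log(1/σ_knob)`; Tao's `M = K¹⁰`); §36 improves the rate to
`Kθ₁ + η` where the output is still `≤ θ₁`. (3) Toy check (kit j094860, j094985, `data/g27-toy`,
117 trajectories, `ε = 10⁻²`): every law holds on every (run, level) pair; with `M/K ≥ 10` the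
deficit IS the input-mode energy at the exit, `δ/a(T₀)² ∈ [0.87, 1.10]`, and §34's lower bound on
`δ` is positive in 90 of 104 (run, level) pairs, the exceptions being quadrature exits (`κ > 10`);
with `M/K ≤ 3` it is vacuous (crude factor `≤ 10⁻²`). `0` named facts; `0` sorry.
[cite: Tao2016AveragedNS, §5.5 Theorem 5.3, (5.5), (5.6), (b-eq), proof (ob-2),
("comparison argument")].
-/

noncomputable section

namespace Summit.NavierStokesRegularity.FluidComputer.GateBudget

open Real Set Filter Topology
open Literature.Analysis.FluidPDE.Tao2016AveragedNS

/-! ## §30 The pulse band: the carrier cannot be drained faster than `2(2ε + K)` -/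

/-- **PULSE BAND (crude carrier law), knob family.** Along `rotorCircuit K M ε ρ` (`0 < ε`,
`ρ² ≤ ε`, `0 ≤ M`, `0 ≤ K`) from `delayInit`, for `0 ≤ s ≤ t`:
`e^{-2(2ε+K)(t-s)}·(a(s)² + d(s)²) ≤ a(t)² + d(t)²` — part 9's `carrier_crude_lower` with the clock
bound `|b| ≤ 1` and the seed `ρ²e^{-M} ≤ ε`. [cite: Tao2016AveragedNS, §5.5 Theorem 5.3, (5.5)] -/
theorem knob_carrier_crude_lower {K M ε ρ : ℝ} {X : ℝ → Fin 5 → ℝ}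
    (hX : ∀ t, HasDerivAt X (RotorKnob.rotorCircuit K M ε ρ (X t)) t) (h0 : X 0 = delayInit)
    (hε : 0 < ε) (hρε : ρ ^ 2 ≤ ε) (hM : 0 ≤ M) (hK : 0 ≤ K) {s t : ℝ} (hs : 0 ≤ s)
    (hst : s ≤ t) :
    exp (-(2 * (2 * ε + K) * (t - s))) * (X s 0 ^ 2 + X s 3 ^ 2) ≤ X t 0 ^ 2 + X t 3 ^ 2 := by
  rw [RotorKnob.rotorCircuit_eq_fiveGate] at hX
  obtain ⟨hσ0, hσε⟩ := knob_seed_le hε hρε hM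
  have hb : ∀ r ∈ Icc s t, |X r 1| ≤ 1 := fun r _ => traj_abs_le_one hX h0 r 1
  have h := carrier_crude_lower hX h0 hε.le hσ0 hK hs hst hb
  have hE0 : 0 ≤ X s 0 ^ 2 + X s 3 ^ 2 := by positivity
  have hts : 0 ≤ t - s := by linarith
  have hrate : -(2 * (2 * ε + K) * (t - s))
      ≤ -(2 * (ε * 1 + ρ ^ 2 * exp (-M) + K) * (t - s)) := by nlinarith
  exact (mul_le_mul_of_nonneg_right (exp_le_exp.2 hrate) hE0).trans h

/-! ## §31 The end-game: with the clock dead the input mode is frozen -/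

/-- **END-GAME FREEZE, knob family.** Along `rotorCircuit K M ε ρ` (`0 < ρ² ≤ ε ≤ 1`, `0 < M`), if
the clock is dead at level `b ≤ -β` (`β > 0`) on `[T,T'] ⊆ [0,∞)`, then for `t ∈ [T,T']`:
`a(T)² - 2ε·(u(T) + ε + 2e^{-M}(t - T))/(Mβ) ≤ a(t)²` (`u = c/ρ²`): part 5's afterglow law
`carrier_freeze` in knob units — the catalyst decays at rate `≥ Mβ/ε`, so its remaining action on
the input mode is `≲ ε·u(T)/(Mβ)`. [cite: Tao2016AveragedNS, §5.5 (5.5), ("comparison argument")] -/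
theorem knob_carrier_freeze {K M ε ρ : ℝ} {X : ℝ → Fin 5 → ℝ}
    (hX : ∀ t, HasDerivAt X (RotorKnob.rotorCircuit K M ε ρ (X t)) t) (h0 : X 0 = delayInit)
    (hε : 0 < ε) (hε1 : ε ≤ 1) (hρ : 0 < ρ) (hρε : ρ ^ 2 ≤ ε) (hM : 0 < M) {T T' β : ℝ}
    (hT : 0 ≤ T) (hβ : 0 < β) (hb : ∀ t ∈ Icc T T', X t 1 ≤ -β) {t : ℝ} (ht : t ∈ Icc T T') :
    X T 0 ^ 2 - 2 * ε * (X T 2 / ρ ^ 2 + ε + 2 * exp (-M) * (t - T)) / (M * β) ≤ X t 0 ^ 2 := by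
  have hc1 : |X T 2| ≤ 1 := RotorKnob.traj_abs_le_one hX h0 T 2
  have hc0 : 0 ≤ X T 2 := RotorKnob.c_nonneg hX h0 hT
  rw [RotorKnob.rotorCircuit_eq_fiveGate] at hX
  obtain ⟨hσ0, hσε⟩ := knob_seed_le hε hρε hM.le
  have hμ : 0 < ε⁻¹ * M := by positivity
  have hR : 0 ≤ (ρ ^ 2)⁻¹ := by positivity
  have h := carrier_freeze hX h0 hε.le hσ0 hμ hR hT hβ hb ht
  have hρ2 : 0 < ρ ^ 2 := by positivity
  have htT : 0 ≤ t - T := by linarith [ht.1]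
  have he1 : exp (-M) ≤ 1 := exp_le_one_iff.2 (by linarith)
  have he0 : 0 < exp (-M) := exp_pos _
  have hc1' : X T 2 ≤ 1 := (abs_le.1 hc1).2
  -- the action of the seed terms: `ρ²e^{-M}·c ≤ ε`, `ρ²·(ρ²e^{-M}) ≤ 1`
  have h1 : ρ ^ 2 * exp (-M) * X T 2 ≤ ε := by nlinarith
  have h2 : ρ ^ 2 * (ρ ^ 2 * exp (-M)) * (exp (-M) * (t - T)) ≤ exp (-M) * (t - T) := by
    have hρ1 : ρ ^ 2 ≤ 1 := hρε.trans hε1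
    have : ρ ^ 2 * (ρ ^ 2 * exp (-M)) ≤ 1 := by nlinarith
    nlinarith [mul_le_mul_of_nonneg_right this (mul_nonneg he0.le htT)]
  have core : ((ρ ^ 2)⁻¹ + ρ ^ 2 * exp (-M)) * (X T 2 + ρ ^ 2 * exp (-M) * (t - T))
      = X T 2 / ρ ^ 2 + exp (-M) * (t - T) + ρ ^ 2 * exp (-M) * X T 2
        + ρ ^ 2 * (ρ ^ 2 * exp (-M)) * (exp (-M) * (t - T)) := by
    field_simp
    ring
  have hcore : ((ρ ^ 2)⁻¹ + ρ ^ 2 * exp (-M)) * (X T 2 + ρ ^ 2 * exp (-M) * (t - T))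
      ≤ X T 2 / ρ ^ 2 + ε + 2 * exp (-M) * (t - T) := by
    rw [core]; linarith
  have hMβ : 0 < M * β := by positivity
  have key : 2 * ((ρ ^ 2)⁻¹ + ρ ^ 2 * exp (-M)) * (X T 2 + ρ ^ 2 * exp (-M) * (t - T))
        / (ε⁻¹ * M * β)
      ≤ 2 * ε * (X T 2 / ρ ^ 2 + ε + 2 * exp (-M) * (t - T)) / (M * β) := by
    have heq : 2 * ((ρ ^ 2)⁻¹ + ρ ^ 2 * exp (-M)) * (X T 2 + ρ ^ 2 * exp (-M) * (t - T))
          / (ε⁻¹ * M * β)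
        = 2 * ε * (((ρ ^ 2)⁻¹ + ρ ^ 2 * exp (-M)) * (X T 2 + ρ ^ 2 * exp (-M) * (t - T)))
          / (M * β) := by
      field_simp
    rw [heq]
    exact div_le_div_of_nonneg_right
      (mul_le_mul_of_nonneg_left hcore (by positivity)) hMβ.le
  linarith

/-- **END-GAME FREEZE, self-timed.** Along `rotorCircuit K M ε ρ` (`0 < ρ² ≤ ε ≤ 1`, `0 < M`), if
the clock is dead at `b(T) ≤ -β < 0` at a time `T ≥ 0`, then it stays `≤ -β/2` for a time
`β/(2ε)` (part 5, `clock_stays_reversed`), and on that window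
`a(t)² ≥ a(T)² - 4ε(u(T) + ε)/(Mβ) - 4e^{-M}/M`: the input mode is FROZEN up to the catalyst's
remaining action. [cite: Tao2016AveragedNS, §5.5 (5.5), (b-eq), ("comparison argument")] -/
theorem knob_carrier_freeze_selftimed {K M ε ρ : ℝ} {X : ℝ → Fin 5 → ℝ}
    (hX : ∀ t, HasDerivAt X (RotorKnob.rotorCircuit K M ε ρ (X t)) t) (h0 : X 0 = delayInit)
    (hε : 0 < ε) (hε1 : ε ≤ 1) (hρ : 0 < ρ) (hρε : ρ ^ 2 ≤ ε) (hM : 0 < M) {T β : ℝ}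
    (hT : 0 ≤ T) (hβ : 0 < β) (hbT : X T 1 ≤ -β) {t : ℝ} (ht : t ∈ Icc T (T + β / (2 * ε))) :
    X T 0 ^ 2 - 4 * ε * (X T 2 / ρ ^ 2 + ε) / (M * β) - 4 * exp (-M) / M ≤ X t 0 ^ 2 := by
  have hXf := hX
  rw [RotorKnob.rotorCircuit_eq_fiveGate] at hXf
  have hμ : 0 ≤ ε⁻¹ * M := by positivity
  have hb : ∀ r ∈ Icc T (T + β / (2 * ε)), X r 1 ≤ -(β / 2) := fun r hr =>
    clock_stays_reversed hXf h0 hε hμ hbT hr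
  have hβ2 : 0 < β / 2 := by positivity
  have h := knob_carrier_freeze hX h0 hε hε1 hρ hρε hM hT hβ2 hb ht
  have htT : t - T ≤ β / (2 * ε) := by linarith [ht.2]
  have hu0 : 0 ≤ X T 2 / ρ ^ 2 := div_nonneg (RotorKnob.c_nonneg hX h0 hT) (by positivity)
  have he0 : 0 < exp (-M) := exp_pos _
  have h1 : 2 * exp (-M) * (t - T) ≤ exp (-M) * β / ε := by
    have h1a := mul_le_mul_of_nonneg_left htT (by positivity : (0:ℝ) ≤ 2 * exp (-M))
    have h1b : 2 * exp (-M) * (β / (2 * ε)) = exp (-M) * β / ε := by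
      field_simp
    linarith [h1b ▸ h1a]
  have hMβ : 0 < M * (β / 2) := by positivity
  have h2 : 2 * ε * (X T 2 / ρ ^ 2 + ε + 2 * exp (-M) * (t - T)) / (M * (β / 2))
      ≤ 2 * ε * (X T 2 / ρ ^ 2 + ε + exp (-M) * β / ε) / (M * (β / 2)) :=
    div_le_div_of_nonneg_right (mul_le_mul_of_nonneg_left (by linarith) (by positivity)) hMβ.le
  have h3 : 2 * ε * (X T 2 / ρ ^ 2 + ε + exp (-M) * β / ε) / (M * (β / 2))
      = 4 * ε * (X T 2 / ρ ^ 2 + ε) / (M * β) + 4 * exp (-M) / M := by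
    field_simp
    ring
  linarith [h3 ▸ h2]

/-! ## §32 The duration of the pulse above an exit level -/

/-- **PULSE DURATION, knob family.** Along `rotorCircuit K M ε ρ` (`0 < ρ² ≤ ε`, `0 < M`), let
`0 ≤ s₀ ≤ t₁ ≤ t₂ ≤ T₀` carry the three clock phases of the pulse: ALIVE `b ≥ β > 0` on `[s₀,t₁]`
with `u(s₀) ≥ λ₁ > 0`; TRANSIT on `[t₁,t₂]` with `c ≥ γ ≥ 0`, `Mγ² > ε²`, `b(t₁) ≤ β`, `b(t₂) ≥ -β`;
DEAD `b ≤ -β` on `[t₂,T₀]` with `u(T₀) ≥ λ₀ > εe^{-M}/(Mβ)`. Then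
`T₀ - s₀ ≤ (ε/(Mβ))log(2εt₁/(λ₁ρ²)) + 2εβ/(Mγ² - ε²) + (ε/(Mβ))log(u(t₂)/(λ₀ - εe^{-M}/(Mβ)))`
(parts 10–11: rise residence + clock transit + decay residence). With `β ≍ ε` and `u ≤ √2/σ_knob`
the pulse above `λ₀` lasts `≲ (2ε/(Mβ))·log(1/(λσ_knob))`: LOGARITHMIC in the knob.
[cite: Tao2016AveragedNS, §5.5 (5.5), (b-eq), proof (ob-2), ("comparison argument")] -/
theorem knob_pulse_duration {K M ε ρ : ℝ} {X : ℝ → Fin 5 → ℝ}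
    (hX : ∀ t, HasDerivAt X (RotorKnob.rotorCircuit K M ε ρ (X t)) t) (h0 : X 0 = delayInit)
    (hε : 0 < ε) (hρ : 0 < ρ) (hρε : ρ ^ 2 ≤ ε) (hM : 0 < M)
    {s₀ t₁ t₂ T₀ β γ lam₁ lam₀ : ℝ} (hs₀ : 0 ≤ s₀) (h01 : s₀ ≤ t₁) (h12 : t₁ ≤ t₂)
    (h2T : t₂ ≤ T₀) (hβ : 0 < β) (hγ : 0 ≤ γ) (hγε : ε ^ 2 < M * γ ^ 2) (hlam₁ : 0 < lam₁)
    (hlam₀ : ε * exp (-M) / (M * β) < lam₀)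
    (halive : ∀ t ∈ Icc s₀ t₁, β ≤ X t 1) (hu₁ : lam₁ * ρ ^ 2 ≤ X s₀ 2)
    (htrans : ∀ t ∈ Icc t₁ t₂, γ ≤ X t 2) (hb₁ : X t₁ 1 ≤ β) (hb₂ : -β ≤ X t₂ 1)
    (hdead : ∀ t ∈ Icc t₂ T₀, X t 1 ≤ -β) (hu₀ : lam₀ * ρ ^ 2 ≤ X T₀ 2) :
    T₀ - s₀ ≤ ε * log (2 * ε * t₁ / (lam₁ * ρ ^ 2)) / (M * β)
      + 2 * ε * β / (M * γ ^ 2 - ε ^ 2)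
      + ε * log (X t₂ 2 / ρ ^ 2 / (lam₀ - ε * exp (-M) / (M * β))) / (M * β) := by
  have h1 := knob_rise_residence hX h0 hε hρ hρε hM hs₀ hβ halive (s := s₀) (t := t₁)
    ⟨le_rfl, h01⟩ ⟨h01, le_rfl⟩ h01 hlam₁ hu₁
  have h2 := knob_clock_transit hX h0 hε hM.le hγ hγε htrans (s := t₁) (t := t₂)
    ⟨le_rfl, h12⟩ ⟨h12, le_rfl⟩ h12 hb₁ hb₂
  have h3 := knob_decay_residence hX h0 hε hρ hM (hs₀.trans (h01.trans h12)) hβ hdead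
    (t := T₀) ⟨h2T, le_rfl⟩ hlam₀ hu₀
  linarith

/-! ## §33 Entering the pulse: the carrier is intact up to the trigger budget and the output -/

/-- **CARRIER AT ENTRY, knob family.** Along `rotorCircuit K M ε ρ` (`0 < ε`, `ρ² ≤ ε`, `0 ≤ M`)
from `delayInit`, at any `s ≥ 0`: `1 - 4ε²s² - ã(s)² ≤ a(s)² + d(s)²` — the energy identity
`a² + b² + c² + d² + ã² = 1` and the trigger budget `b² + c² ≤ ((ε + ρ²e^{-M})s)² ≤ 4ε²s²`.
[cite: Tao2016AveragedNS, §5.5 Theorem 5.3, (5.6), proof (ob-2)] -/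
theorem knob_carrier_enter {K M ε ρ : ℝ} {X : ℝ → Fin 5 → ℝ}
    (hX : ∀ t, HasDerivAt X (RotorKnob.rotorCircuit K M ε ρ (X t)) t) (h0 : X 0 = delayInit)
    (hε : 0 < ε) (hρε : ρ ^ 2 ≤ ε) (hM : 0 ≤ M) {s : ℝ} (hs : 0 ≤ s) :
    1 - 4 * ε ^ 2 * s ^ 2 - X s 4 ^ 2 ≤ X s 0 ^ 2 + X s 3 ^ 2 := by
  have hsum := RotorKnob.traj_sum_sq_eq_one hX h0 s
  rw [RotorKnob.rotorCircuit_eq_fiveGate] at hX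
  obtain ⟨hσ0, hσε⟩ := knob_seed_le hε hρε hM
  have htrig := trigger_budget hX h0 hε.le hσ0 hs
  have hbc0 : 0 ≤ X s 1 ^ 2 + X s 2 ^ 2 := by positivity
  have hr0 : 0 ≤ (ε + ρ ^ 2 * exp (-M)) * s := by positivity
  have hsq : X s 1 ^ 2 + X s 2 ^ 2 ≤ ((ε + ρ ^ 2 * exp (-M)) * s) ^ 2 := by
    have h := pow_le_pow_left₀ (sqrt_nonneg _) htrig 2
    rwa [sq_sqrt hbc0] at h
  have h2 : (ε + ρ ^ 2 * exp (-M)) * s ≤ 2 * ε * s :=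
    mul_le_mul_of_nonneg_right (by linarith) hs
  have h4 : ((ε + ρ ^ 2 * exp (-M)) * s) ^ 2 ≤ 4 * ε ^ 2 * s ^ 2 := by
    have h := pow_le_pow_left₀ hr0 h2 2
    nlinarith [h]
  linarith

/-! ## §34 The fired inequality -/

/-- **THE FIRED CARRIER BOUND, knob family.** Along `rotorCircuit K M ε ρ` (`0 < ρ² ≤ ε ≤ 1`,
`0 < M`, `0 ≤ K`): suppose the pulse is entered at `s₀ ≥ 0` and left at `T₀ ≥ s₀` after at most
`τ`, with the clock dead at exit (`b(T₀) ≤ -β < 0`) and with CARRIER PHASE `κ`: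
`a(T₀)² + d(T₀)² ≤ κ·a(T₀)²` (`κ = 1/cos²φ_exit`). Then on the end-game window
`[T₀, T₀ + β/(2ε)]`:
`e^{-2(2ε+K)τ}(1 - 4ε²s₀² - ã(s₀)²)/κ - 4ε(u(T₀) + ε)/(Mβ) - 4e^{-M}/M ≤ a(t)²`
(§33 entry, §30 pulse band, phase, §31 freeze). [cite: Tao2016AveragedNS, §5.5 Theorem 5.3] -/
theorem knob_fired_carrier_lower {K M ε ρ : ℝ} {X : ℝ → Fin 5 → ℝ}
    (hX : ∀ t, HasDerivAt X (RotorKnob.rotorCircuit K M ε ρ (X t)) t) (h0 : X 0 = delayInit)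
    (hε : 0 < ε) (hε1 : ε ≤ 1) (hρ : 0 < ρ) (hρε : ρ ^ 2 ≤ ε) (hM : 0 < M) (hK : 0 ≤ K)
    {s₀ T₀ τ β κ : ℝ} (hs₀ : 0 ≤ s₀) (hsT : s₀ ≤ T₀) (hτ : T₀ - s₀ ≤ τ) (hβ : 0 < β)
    (hbT : X T₀ 1 ≤ -β) (hκ : 0 < κ) (hphase : X T₀ 0 ^ 2 + X T₀ 3 ^ 2 ≤ κ * X T₀ 0 ^ 2)
    {t : ℝ} (ht : t ∈ Icc T₀ (T₀ + β / (2 * ε))) :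
    exp (-(2 * (2 * ε + K) * τ)) * (1 - 4 * ε ^ 2 * s₀ ^ 2 - X s₀ 4 ^ 2) / κ
      - 4 * ε * (X T₀ 2 / ρ ^ 2 + ε) / (M * β) - 4 * exp (-M) / M ≤ X t 0 ^ 2 := by
  have hent := knob_carrier_enter hX h0 hε hρε hM.le hs₀
  have hcr := knob_carrier_crude_lower hX h0 hε hρε hM.le hK hs₀ hsT
  have hfr := knob_carrier_freeze_selftimed hX h0 hε hε1 hρ hρε hM (hs₀.trans hsT) hβ hbT ht
  have hE0 : 0 ≤ X s₀ 0 ^ 2 + X s₀ 3 ^ 2 := by positivity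
  have hexp : exp (-(2 * (2 * ε + K) * τ)) ≤ exp (-(2 * (2 * ε + K) * (T₀ - s₀))) := by
    refine exp_le_exp.2 ?_
    have : 0 ≤ 2 * (2 * ε + K) := by positivity
    nlinarith
  have hchain : exp (-(2 * (2 * ε + K) * τ)) * (1 - 4 * ε ^ 2 * s₀ ^ 2 - X s₀ 4 ^ 2)
      ≤ κ * X T₀ 0 ^ 2 :=
    calc exp (-(2 * (2 * ε + K) * τ)) * (1 - 4 * ε ^ 2 * s₀ ^ 2 - X s₀ 4 ^ 2)
        ≤ exp (-(2 * (2 * ε + K) * τ)) * (X s₀ 0 ^ 2 + X s₀ 3 ^ 2) :=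
          mul_le_mul_of_nonneg_left hent (exp_pos _).le
      _ ≤ exp (-(2 * (2 * ε + K) * (T₀ - s₀))) * (X s₀ 0 ^ 2 + X s₀ 3 ^ 2) :=
          mul_le_mul_of_nonneg_right hexp hE0
      _ ≤ X T₀ 0 ^ 2 + X T₀ 3 ^ 2 := hcr
      _ ≤ κ * X T₀ 0 ^ 2 := hphase
  have hdiv : exp (-(2 * (2 * ε + K) * τ)) * (1 - 4 * ε ^ 2 * s₀ ^ 2 - X s₀ 4 ^ 2) / κ
      ≤ X T₀ 0 ^ 2 := by
    rw [div_le_iff₀ hκ]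
    linarith
  linarith

/-- **THE FIRED INEQUALITY (single-trajectory necessity), knob family.** In the setting of
`knob_fired_carrier_lower`, if moreover the device has FIRED to deficit `δ` at some time `t_f` of
the end-game window (`ã(t_f)² ≥ 1 - δ`), then
`e^{-2(2ε+K)τ}·(1 - 4ε²s₀² - ã(s₀)²) ≤ κ·(δ + 4ε(u(T₀) + ε)/(Mβ) + 4e^{-M}/M)`:
the carrier that survives a pulse of length `τ` must fit into the deficit plus the catalyst's
remaining action, up to the exit phase `κ`. [cite: Tao2016AveragedNS, §5.5 Theorem 5.3, (5.6)] -/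
theorem knob_fired_necessity {K M ε ρ : ℝ} {X : ℝ → Fin 5 → ℝ}
    (hX : ∀ t, HasDerivAt X (RotorKnob.rotorCircuit K M ε ρ (X t)) t) (h0 : X 0 = delayInit)
    (hε : 0 < ε) (hε1 : ε ≤ 1) (hρ : 0 < ρ) (hρε : ρ ^ 2 ≤ ε) (hM : 0 < M) (hK : 0 ≤ K)
    {s₀ T₀ τ β κ : ℝ} (hs₀ : 0 ≤ s₀) (hsT : s₀ ≤ T₀) (hτ : T₀ - s₀ ≤ τ) (hβ : 0 < β)
    (hbT : X T₀ 1 ≤ -β) (hκ : 0 < κ) (hphase : X T₀ 0 ^ 2 + X T₀ 3 ^ 2 ≤ κ * X T₀ 0 ^ 2)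
    {t_f δ : ℝ} (htf : t_f ∈ Icc T₀ (T₀ + β / (2 * ε))) (hfired : 1 - δ ≤ X t_f 4 ^ 2) :
    exp (-(2 * (2 * ε + K) * τ)) * (1 - 4 * ε ^ 2 * s₀ ^ 2 - X s₀ 4 ^ 2)
      ≤ κ * (δ + 4 * ε * (X T₀ 2 / ρ ^ 2 + ε) / (M * β) + 4 * exp (-M) / M) := by
  have h := knob_fired_carrier_lower hX h0 hε hε1 hρ hρε hM hK hs₀ hsT hτ hβ hbT hκ hphase htf
  have hsum := RotorKnob.traj_sum_sq_eq_one hX h0 t_f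
  have ha : X t_f 0 ^ 2 ≤ δ := by
    nlinarith [sq_nonneg (X t_f 1), sq_nonneg (X t_f 2), sq_nonneg (X t_f 3)]
  have hdiv : exp (-(2 * (2 * ε + K) * τ)) * (1 - 4 * ε ^ 2 * s₀ ^ 2 - X s₀ 4 ^ 2) / κ
      ≤ δ + 4 * ε * (X T₀ 2 / ρ ^ 2 + ε) / (M * β) + 4 * exp (-M) / M := by linarith
  rw [div_le_iff₀ hκ] at hdiv
  linarith

/-! ## §35 The skeleton: duration substituted -/

/-- **THE SINGLE-TRAJECTORY NECESSITY SKELETON, knob family** (SPEC-INPUT-bp1 S13″d). Along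
`rotorCircuit K M ε ρ` (`0 < ρ² ≤ ε ≤ 1`, `0 < M`, `0 ≤ K`) from `delayInit`, with the clock
phases of `knob_pulse_duration` on `s₀ ≤ t₁ ≤ t₂ ≤ T₀` (alive at `β` / transit above `γ` / dead at
`β`), entry level `u(s₀) ≥ λ₁`, EXIT `u(T₀) = λ₀ > εe^{-M}/(Mβ)`, exit phase
`a(T₀)² + d(T₀)² ≤ κa(T₀)²`, and fired to deficit `δ` at `t_f ∈ [T₀, T₀ + β/(2ε)]`:
`e^{-2(2ε+K)τ*}·(1 - 4ε²s₀² - ã(s₀)²) ≤ κ(δ + 4ε(λ₀ + ε)/(Mβ) + 4e^{-M}/M)` with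
`τ* = (ε/(Mβ))log(2εt₁/(λ₁ρ²)) + 2εβ/(Mγ² - ε²) + (ε/(Mβ))log(u(t₂)/(λ₀ - εe^{-M}/(Mβ)))`.
READING (`β ≍ ε`, `u ≤ √2/σ_knob`): `e^{-2(2ε+K)τ*} ≍ σ_knob^{4Kε/(Mβ)}`, so robust firing to
deficit `δ` before the output has grown at entry FORCES `σ_knob^{4Kε/(Mβ)} ≲ κδ` — UNLESS the
carrier exits the pulse in quadrature (`κ ≫ 1`, the open phase-selection item S13″c).
[cite: Tao2016AveragedNS, §5.5 Theorem 5.3, (5.5), (5.6), (b-eq), proof (ob-2)] -/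
theorem knob_necessity_skeleton {K M ε ρ : ℝ} {X : ℝ → Fin 5 → ℝ}
    (hX : ∀ t, HasDerivAt X (RotorKnob.rotorCircuit K M ε ρ (X t)) t) (h0 : X 0 = delayInit)
    (hε : 0 < ε) (hε1 : ε ≤ 1) (hρ : 0 < ρ) (hρε : ρ ^ 2 ≤ ε) (hM : 0 < M) (hK : 0 ≤ K)
    {s₀ t₁ t₂ T₀ β γ lam₁ lam₀ κ t_f δ : ℝ} (hs₀ : 0 ≤ s₀) (h01 : s₀ ≤ t₁) (h12 : t₁ ≤ t₂)
    (h2T : t₂ ≤ T₀) (hβ : 0 < β) (hγ : 0 ≤ γ) (hγε : ε ^ 2 < M * γ ^ 2) (hlam₁ : 0 < lam₁)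
    (hlam₀ : ε * exp (-M) / (M * β) < lam₀)
    (halive : ∀ t ∈ Icc s₀ t₁, β ≤ X t 1) (hu₁ : lam₁ * ρ ^ 2 ≤ X s₀ 2)
    (htrans : ∀ t ∈ Icc t₁ t₂, γ ≤ X t 2) (hb₁ : X t₁ 1 ≤ β) (hb₂ : -β ≤ X t₂ 1)
    (hdead : ∀ t ∈ Icc t₂ T₀, X t 1 ≤ -β) (hexit : X T₀ 2 = lam₀ * ρ ^ 2) (hκ : 0 < κ)
    (hphase : X T₀ 0 ^ 2 + X T₀ 3 ^ 2 ≤ κ * X T₀ 0 ^ 2)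
    (htf : t_f ∈ Icc T₀ (T₀ + β / (2 * ε))) (hfired : 1 - δ ≤ X t_f 4 ^ 2) :
    exp (-(2 * (2 * ε + K) * (ε * log (2 * ε * t₁ / (lam₁ * ρ ^ 2)) / (M * β)
        + 2 * ε * β / (M * γ ^ 2 - ε ^ 2)
        + ε * log (X t₂ 2 / ρ ^ 2 / (lam₀ - ε * exp (-M) / (M * β))) / (M * β))))
      * (1 - 4 * ε ^ 2 * s₀ ^ 2 - X s₀ 4 ^ 2)
      ≤ κ * (δ + 4 * ε * (lam₀ + ε) / (M * β) + 4 * exp (-M) / M) := by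
  have hτ := knob_pulse_duration hX h0 hε hρ hρε hM hs₀ h01 h12 h2T hβ hγ hγε hlam₁ hlam₀ halive
    hu₁ htrans hb₁ hb₂ hdead hexit.symm.le
  have hbT : X T₀ 1 ≤ -β := hdead T₀ (right_mem_Icc.2 h2T)
  have h := knob_fired_necessity hX h0 hε hε1 hρ hρε hM hK hs₀ (h01.trans (h12.trans h2T)) hτ hβ
    hbT hκ hphase htf hfired
  have hu : X T₀ 2 / ρ ^ 2 = lam₀ := by
    rw [hexit]
    field_simp
  rwa [hu] at h

/-! ## §36 Refinement: three bands — part 9's envelope law on the top of the pulse -/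

/-- **THREE-BAND CARRIER LAW, knob family.** Along `rotorCircuit K M ε ρ` (`0 < ρ² ≤ ε ≤ 1`,
`0 ≤ M`, `0 ≤ K`), split `[s₀,T₀]` (`s₀ ≥ 0`) into a rise band `[s₀,s₁]`, a TOP band `[s₁,T₁]` on
which the rotor over-turns the drain, `u ≥ Λ` with `Λ ≥ max(1,K)`, while the output is still
`ã ≤ θ₁`, and a fall band `[T₁,T₀]`. Then
`(1/3)·e^{-2(2ε+K)((s₁-s₀)+(T₀-T₁))}·e^{-(Kθ₁+η)(T₁-s₁)}·E(s₀) ≤ E(T₀)`,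
`η = 8ε²T₁ + 4εe^{-M} + (K/Λ)(K + 2(M+1)T₁ + 2)` (§30 twice + part 9 `rotorKnob_carrier_ceiling`):
on the top band the drain sees only the AVERAGED carrier, rate `Kθ₁ + η` instead of `2(2ε + K)` —
a gain exactly when the output is still small there (`θ₁ ≪ 1`) and the pulse is high
(`Λ ≫ K + 2(M+1)T₁`, i.e. `σ_knob ≪ 1/(K + MT₁)`); with `θ₁ = 1` only the factor `2` in the rate
survives, against the prefactor `1/3` — immaterial where §35 has content (`K(T₀ - s₀) ≪ 1`),
which is why the skeleton uses the crude band. [cite: Tao2016AveragedNS, §5.5 Theorem 5.3, (5.5)] -/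
theorem knob_carrier_three_bands {K M ε ρ : ℝ} {X : ℝ → Fin 5 → ℝ}
    (hX : ∀ t, HasDerivAt X (RotorKnob.rotorCircuit K M ε ρ (X t)) t) (h0 : X 0 = delayInit)
    (hε : 0 < ε) (hε1 : ε ≤ 1) (hρ : 0 < ρ) (hρε : ρ ^ 2 ≤ ε) (hM : 0 ≤ M) (hK : 0 ≤ K)
    {s₀ s₁ T₁ T₀ lam θ₁ : ℝ} (hs₀ : 0 ≤ s₀) (h01 : s₀ ≤ s₁) (h1T : s₁ ≤ T₁) (hT10 : T₁ ≤ T₀)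
    (hlam : 1 ≤ lam) (hKl : K ≤ lam) (hu : ∀ t ∈ Icc s₁ T₁, lam * ρ ^ 2 ≤ X t 2)
    (he : ∀ t ∈ Icc s₁ T₁, X t 4 ≤ θ₁) :
    1 / 3 * exp (-(2 * (2 * ε + K) * ((s₁ - s₀) + (T₀ - T₁))))
      * exp (-((K * θ₁ + (8 * ε ^ 2 * T₁ + 4 * ε * exp (-M)
          + K / lam * (K + 2 * (M + 1) * T₁ + 2))) * (T₁ - s₁))) * (X s₀ 0 ^ 2 + X s₀ 3 ^ 2)
      ≤ X T₀ 0 ^ 2 + X T₀ 3 ^ 2 := by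
  have h1 := knob_carrier_crude_lower hX h0 hε hρε hM hK hs₀ h01
  have h2 := rotorKnob_carrier_ceiling hX h0 hε hε1 hρ hρε hM hK (hs₀.trans h01) hlam hKl hu he
    (t := T₁) ⟨h1T, le_rfl⟩
  have h3 := knob_carrier_crude_lower hX h0 hε hρε hM hK (hs₀.trans (h01.trans h1T)) hT10
  have hE1 : 0 ≤ 1 / 3 * exp (-((K * θ₁ + (8 * ε ^ 2 * T₁ + 4 * ε * exp (-M)
      + K / lam * (K + 2 * (M + 1) * T₁ + 2))) * (T₁ - s₁))) := by positivity
  have key : 1 / 3 * exp (-(2 * (2 * ε + K) * ((s₁ - s₀) + (T₀ - T₁))))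
      * exp (-((K * θ₁ + (8 * ε ^ 2 * T₁ + 4 * ε * exp (-M)
          + K / lam * (K + 2 * (M + 1) * T₁ + 2))) * (T₁ - s₁))) * (X s₀ 0 ^ 2 + X s₀ 3 ^ 2)
      = exp (-(2 * (2 * ε + K) * (T₀ - T₁))) * (1 / 3 * exp (-((K * θ₁ + (8 * ε ^ 2 * T₁
          + 4 * ε * exp (-M) + K / lam * (K + 2 * (M + 1) * T₁ + 2))) * (T₁ - s₁)))
          * (exp (-(2 * (2 * ε + K) * (s₁ - s₀))) * (X s₀ 0 ^ 2 + X s₀ 3 ^ 2))) := by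
    rw [show -(2 * (2 * ε + K) * ((s₁ - s₀) + (T₀ - T₁)))
        = -(2 * (2 * ε + K) * (s₁ - s₀)) + -(2 * (2 * ε + K) * (T₀ - T₁)) by ring, exp_add]
    ring
  rw [key]
  calc exp (-(2 * (2 * ε + K) * (T₀ - T₁))) * (1 / 3 * exp (-((K * θ₁ + (8 * ε ^ 2 * T₁
          + 4 * ε * exp (-M) + K / lam * (K + 2 * (M + 1) * T₁ + 2))) * (T₁ - s₁)))
          * (exp (-(2 * (2 * ε + K) * (s₁ - s₀))) * (X s₀ 0 ^ 2 + X s₀ 3 ^ 2)))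
      ≤ exp (-(2 * (2 * ε + K) * (T₀ - T₁))) * (1 / 3 * exp (-((K * θ₁ + (8 * ε ^ 2 * T₁
          + 4 * ε * exp (-M) + K / lam * (K + 2 * (M + 1) * T₁ + 2))) * (T₁ - s₁)))
          * (X s₁ 0 ^ 2 + X s₁ 3 ^ 2)) :=
        mul_le_mul_of_nonneg_left (mul_le_mul_of_nonneg_left h1 hE1) (exp_pos _).le
    _ ≤ exp (-(2 * (2 * ε + K) * (T₀ - T₁))) * (X T₁ 0 ^ 2 + X T₁ 3 ^ 2) :=
        mul_le_mul_of_nonneg_left h2 (exp_pos _).le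
    _ ≤ X T₀ 0 ^ 2 + X T₀ 3 ^ 2 := h3

end Summit.NavierStokesRegularity.FluidComputer.GateBudget
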